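import Mathlib.NumberTheory.Padics.PadicIntegers
import Mathlib.GroupTheory.GroupAction.Quotient
import Mathlib.Algebra.Order.Field.Basic
import HarnessLib

/-!
# Connes–Consani 2024, *Knots, primes and the adele class space* — the semilocal orbit over `C_p` (Prop. 3.1 (iii) = Thm. 1.2), PROVED

A. Connes, C. Consani, *Knots, Primes and the adele class space*, arXiv:2401.08401 (2024)
[bib: `ConnesConsani2024KnotsPrimes`], §3 "The semilocal space `Γ\(ℚ_p × ℚ_q × ℝ)`" (p. 6).  Cell
`pub-rhdoor` (motivic door), seat cc-2: the SEMI-LOCAL (`S = {p, q, ∞}`) item of the Connes–Consani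
sequels, typed verbatim and PROVED.  No positivity content (it is the topology of the periodic orbit
`C_p`); recorded as a typed skeleton for the cell's semi-local seats.

## What is printed (§3, p. 6)

* `𝔸_{ℚ,S} = Π_{v∈S} ℚ_v`, `𝒪_{ℚ,S} = ℤ[1/p, 1/q]`, `Γ = GL₁(𝒪_{ℚ,S}) = {± p^m q^n : m, n ∈ ℤ}` (eq. (Γ)),
  acting diagonally; the semilocal adele class space `X^{ab}_{ℚ,S} := Γ\𝔸_{ℚ,S}`.
* **Proposition 3.1.** "(i) The orbits of the action of the group `J_S` on `X^{ab}_{ℚ,S}` are indexed by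
  the subsets of `S = {p, q, ∞}` as follows
  `Ω_Z := Γ\{(a_v) ∈ 𝔸_{ℚ,S} | a_v = 0 ∀ v ∈ Z, a_v ≠ 0 ∀ v ∉ Z}`, `Z ⊂ S`.  (ii) The orbit `Ω_{{p}}` … is
  the inverse image `π_S⁻¹(C_p)` of the periodic orbit `C_p` of length `log p` ….  (iii) The orbit
  `π_S⁻¹(C_p)` is equivariantly isomorphic to the mapping torus of the multiplication by `p` in the compact
  group `ℤ_q^*`."  Proof of (iii), verbatim: "The action of `{±q^n}` on `{0} × (ℚ_q ∖ {0}) × ℝ^*` admits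
  `{0} × ℤ_q^* × ℝ_+^*` as fundamental domain. This domain is preserved under the action of `p^ℤ`. The
  quotient `p^ℤ\(ℤ_q^* × ℝ_+^*)` is the mapping torus of the multiplication by `p` in the compact group `ℤ_q^*`."
* **Theorem 1.2** (p. 3) is Prop. 3.1 (iii) plus two class-field-theory identifications (p. 6, proof of
  Thm. 1.2): `π₁^{et}(Spec ℤ[1/q])^{ab} ≅ ℤ_q^*` (maximal abelian extension of `ℚ` ramified only at `q`,
  [Lenstra] Cor. 6.17) and `{Frob_p} ↦ p ∈ ℤ_q^*`.  These are NOT formalised (no étale `π₁` in Mathlib);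
  we type the mapping torus directly on `ℤ_q^*` with "Frobenius = multiplication by `p`", which is the
  printed content of Prop. 3.1 (iii).

## What is typed and proved

`Gamma p q ≤ ℚˣ` (`{±p^m q^n}`) acting diagonally on `SemilocalAdeles p q := ℚ_[p] × ℚ_[q] × ℝ` through
the `ℚ`-vector-space structures; `SemilocalClassSpace p q := Γ\𝔸_{ℚ,S}` (orbit space); `omegaP` =
`Ω_{{p}}` (classes of `(0, b, c)`, `b ≠ 0`, `c ≠ 0`); the mapping torus `MappingTorus p q :=
p^ℤ\(ℤ_q^* × ℝ_+^*)`; the map `torusToClass : MappingTorus p q → Γ\𝔸_{ℚ,S}`, `[(u, c)] ↦ [(0, u, c)]`.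
PROVED: `torusToClass` is well defined and injective with range exactly `Ω_{{p}}`
(`torusToClass_injective`, `range_torusToClass`) — the fundamental-domain argument of the printed proof,
with `p`-adic valuations — whence `mappingTorusEquivOmegaP : MappingTorus p q ≃ Ω_{{p}}` (Prop. 3.1 (iii));
equivariance for the scaling action of `ℝ_+^*` on the archimedean coordinate: `torusToClass_scale`.
-/

noncomputable section

open Set

namespace Literature.NumberTheory.ConnesConsani2024

section Semilocal

variable (p q : ℕ) [hp : Fact p.Prime] [hq : Fact q.Prime]

/-! ## `Γ = {± p^m q^n}` and the semilocal adele class space `Γ\(ℚ_p × ℚ_q × ℝ)` -/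

/-- `Γ = GL₁(𝒪_{ℚ,S}) = {± p^m q^n : m, n ∈ ℤ}` for `S = {p, q, ∞}` (eq. (Γ), §3 p. 6), as a subgroup of
`ℚˣ`; the sign is recorded as `ε ∈ {1, −1} ⊂ ℚ`. [cite: ConnesConsani2024KnotsPrimes, §3 eq. (Γ) p. 6] -/
def Gamma : Subgroup ℚˣ where
  carrier := {u | ∃ (ε : ℚ) (m n : ℤ), (ε = 1 ∨ ε = -1) ∧ (u : ℚ) = ε * (p : ℚ) ^ m * (q : ℚ) ^ n}
  one_mem' := ⟨1, 0, 0, Or.inl rfl, by simp⟩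
  mul_mem' := by
    rintro u v ⟨ε, m, n, hε, hu⟩ ⟨ε', m', n', hε', hv⟩
    have hp0 : (p : ℚ) ≠ 0 := by exact_mod_cast hp.out.ne_zero
    have hq0 : (q : ℚ) ≠ 0 := by exact_mod_cast hq.out.ne_zero
    refine ⟨ε * ε', m + m', n + n', ?_, ?_⟩
    · rcases hε with rfl | rfl <;> rcases hε' with rfl | rfl <;> norm_num
    · rw [Units.val_mul, hu, hv, zpow_add₀ hp0, zpow_add₀ hq0]
      ring
  inv_mem' := by
    rintro u ⟨ε, m, n, hε, hu⟩
    have hεinv : ε⁻¹ = ε := by rcases hε with rfl | rfl <;> norm_num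
    refine ⟨ε, -m, -n, hε, ?_⟩
    rw [Units.val_inv_eq_inv_val, hu, mul_inv, mul_inv, hεinv, zpow_neg, zpow_neg]

/-- Membership in `Γ`. [cite: ConnesConsani2024KnotsPrimes, §3 eq. (Γ) p. 6] -/
theorem mem_Gamma {u : ℚˣ} :
    u ∈ Gamma p q ↔ ∃ (ε : ℚ) (m n : ℤ), (ε = 1 ∨ ε = -1) ∧ (u : ℚ) = ε * (p : ℚ) ^ m * (q : ℚ) ^ n :=
  Iff.rfl

/-- The semilocal adeles `𝔸_{ℚ,S} = ℚ_p × ℚ_q × ℝ` for `S = {p, q, ∞}` (§3 p. 6).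
[cite: ConnesConsani2024KnotsPrimes, §3 p. 6] -/
abbrev SemilocalAdeles : Type := ℚ_[p] × ℚ_[q] × ℝ

/-- The diagonal action of `ℚˣ ⊇ Γ` on `𝔸_{ℚ,S}` is coordinatewise multiplication by the rational number.
[folklore] -/
private theorem units_smul_def (u : ℚˣ) (a : ℚ_[p]) (b : ℚ_[q]) (c : ℝ) :
    u • ((a, b, c) : SemilocalAdeles p q) = (((u : ℚ) : ℚ_[p]) * a, ((u : ℚ) : ℚ_[q]) * b, ((u : ℚ) : ℝ) * c) := by
  rw [Units.smul_def]
  simp only [Prod.smul_mk, Rat.smul_def]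

/-- **The semilocal adele class space** `X^{ab}_{ℚ,S} := Γ\𝔸_{ℚ,S}` (§3 p. 6): the space of `Γ`-orbits.
[cite: ConnesConsani2024KnotsPrimes, §3 p. 6] -/
abbrev SemilocalClassSpace : Type :=
  MulAction.orbitRel.Quotient (Gamma p q) (SemilocalAdeles p q)

/-- The class of an adele. [cite: ConnesConsani2024KnotsPrimes, §3 p. 6] -/
def cls (x : SemilocalAdeles p q) : SemilocalClassSpace p q :=
  (Quotient.mk _ x : MulAction.orbitRel.Quotient (Gamma p q) (SemilocalAdeles p q))

/-- Two adeles have the same class in `X^{ab}_{ℚ,S} = Γ\𝔸_{ℚ,S}` iff they differ by an element of `Γ`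
(the definition of the quotient, §3 p. 6). [cite: ConnesConsani2024KnotsPrimes, §3 p. 6] -/
theorem cls_eq_cls_iff {x y : SemilocalAdeles p q} :
    cls p q x = cls p q y ↔ ∃ γ : Gamma p q, γ • y = x := by
  rw [cls, cls, Quotient.eq]
  exact MulAction.orbitRel_apply.trans MulAction.mem_orbit_iff

/-- **The orbit `Ω_{{p}} = π_S⁻¹(C_p)`** (Prop. 3.1 (i)–(ii), p. 6): classes of adeles `(a_p, a_q, a_∞)` with
`a_p = 0`, `a_q ≠ 0`, `a_∞ ≠ 0`. [cite: ConnesConsani2024KnotsPrimes, Prop. 3.1 (i)–(ii) p. 6] -/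
def omegaP : Set (SemilocalClassSpace p q) :=
  {x | ∃ (b : ℚ_[q]) (c : ℝ), b ≠ 0 ∧ c ≠ 0 ∧ x = cls p q ((0 : ℚ_[p]), b, c)}

/-- `p^n ∈ Γ`. [folklore] -/
private theorem pZpow_mem_Gamma (n : ℤ) :
    Units.mk0 ((p : ℚ) ^ n) (zpow_ne_zero n (by exact_mod_cast hp.out.ne_zero)) ∈ Gamma p q :=
  ⟨1, n, 0, Or.inl rfl, by simp⟩

/-! ## The mapping torus `p^ℤ\(ℤ_q^* × ℝ_+^*)` -/

variable [hpq : Fact (p ≠ q)]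

/-- `‖p‖_q = 1` (`p ≠ q`), i.e. `p ∈ ℤ_q^*` — the image of `{Frob_p}` (proof of Thm. 1.2, p. 6:
"`π₁^{et}(r^*){Frob_p}` is equal to `p ∈ ℤ_q^*`"). [cite: ConnesConsani2024KnotsPrimes, proof of Thm. 1.2 p. 6] -/
theorem norm_p_Qq : ‖(p : ℚ_[q])‖ = 1 := by
  have h1 : ‖((p : ℤ) : ℚ_[q])‖ ≤ 1 := Padic.norm_int_le_one _
  have h2 : ¬ ‖((p : ℤ) : ℚ_[q])‖ < 1 := by
    rw [Padic.norm_intCast_lt_one_iff]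
    intro hdvd
    have : q ∣ p := by exact_mod_cast hdvd
    exact hpq.out ((Nat.prime_dvd_prime_iff_eq hq.out hp.out).mp this).symm
  push_cast at h1 h2
  exact le_antisymm h1 (not_lt.mp h2)

/-- The fundamental domain `ℤ_q^* × ℝ_+^*` (proof of Prop. 3.1 (iii)). [cite: ConnesConsani2024KnotsPrimes, proof of Prop. 3.1 (iii) p. 6] -/
abbrev TorusDomain : Type := ℤ_[q]ˣ × {c : ℝ // 0 < c}

/-- The `p^ℤ`-action on the fundamental domain, `n · (u, c) = (p^n u, p^n c)` ("This domain is preserved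
under the action of `p^ℤ`"), as the induced relation; the `ℤ_q^*`-component is compared inside `ℚ_q`.
[cite: ConnesConsani2024KnotsPrimes, proof of Prop. 3.1 (iii) p. 6] -/
def torusSetoid : Setoid (TorusDomain q) where
  r x y := ∃ n : ℤ, ((y.1 : ℤ_[q]) : ℚ_[q]) = (p : ℚ_[q]) ^ n * ((x.1 : ℤ_[q]) : ℚ_[q]) ∧
    (y.2 : ℝ) = (p : ℝ) ^ n * x.2
  iseqv := by
    have hp0 : (p : ℝ) ≠ 0 := by exact_mod_cast hp.out.ne_zero
    have hp0' : (p : ℚ_[q]) ≠ 0 := by exact_mod_cast hp.out.ne_zero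
    refine ⟨fun x => ⟨0, by simp, by simp⟩, ?_, ?_⟩
    · rintro x y ⟨n, h1, h2⟩
      refine ⟨-n, ?_, ?_⟩
      · rw [h1, ← mul_assoc, ← zpow_add₀ hp0', neg_add_cancel, zpow_zero, one_mul]
      · rw [h2, ← mul_assoc, ← zpow_add₀ hp0, neg_add_cancel, zpow_zero, one_mul]
    · rintro x y z ⟨n, h1, h2⟩ ⟨n', h1', h2'⟩
      refine ⟨n' + n, ?_, ?_⟩
      · rw [h1', h1, ← mul_assoc, ← zpow_add₀ hp0']
      · rw [h2', h2, ← mul_assoc, ← zpow_add₀ hp0]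

/-- **The mapping torus** `p^ℤ\(ℤ_q^* × ℝ_+^*)` "of the multiplication by `p` in the compact group `ℤ_q^*`"
(Prop. 3.1 (iii), p. 6). [cite: ConnesConsani2024KnotsPrimes, Prop. 3.1 (iii) p. 6] -/
def MappingTorus : Type := Quotient (torusSetoid p q)

/-- The point of `Γ\𝔸_{ℚ,S}` attached to `(u, c) ∈ ℤ_q^* × ℝ_+^*`: the class of `(0, u, c)`. [folklore] -/
private def domainToClass (x : TorusDomain q) : SemilocalClassSpace p q :=
  cls p q ((0 : ℚ_[p]), ((x.1 : ℤ_[q]) : ℚ_[q]), (x.2 : ℝ))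

omit hpq in
/-- `p^ℤ`-related points of the fundamental domain have the same class. [folklore] -/
private theorem domainToClass_sound (x y : TorusDomain q) (h : (torusSetoid p q).r x y) :
    domainToClass p q x = domainToClass p q y := by
  obtain ⟨n, h1, h2⟩ := h
  rw [domainToClass, domainToClass, cls_eq_cls_iff]
  refine ⟨⟨_, pZpow_mem_Gamma p q (-n)⟩, ?_⟩
  rw [Subgroup.mk_smul, units_smul_def, h1, h2]
  have hp0 : (p : ℚ_[q]) ≠ 0 := by exact_mod_cast hp.out.ne_zero
  have hp0' : (p : ℝ) ≠ 0 := by exact_mod_cast hp.out.ne_zero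
  simp only [Units.val_mk0, mul_zero]
  push_cast
  rw [← mul_assoc, ← zpow_add₀ hp0, ← mul_assoc, ← zpow_add₀ hp0']
  simp

/-- **The map `p^ℤ\(ℤ_q^* × ℝ_+^*) → Γ\𝔸_{ℚ,S}`, `[(u, c)] ↦ [(0, u, c)]`** (Prop. 3.1 (iii)).
[cite: ConnesConsani2024KnotsPrimes, Prop. 3.1 (iii) p. 6] -/
def torusToClass : MappingTorus p q → SemilocalClassSpace p q :=
  Quotient.lift (domainToClass p q) (domainToClass_sound p q)

/-- Units of `ℤ_q` have `q`-adic norm `1` in `ℚ_q`. [folklore] -/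
private theorem norm_coe_unit (u : ℤ_[q]ˣ) : ‖(((u : ℤ_[q]) : ℚ_[q]))‖ = 1 := by
  rw [PadicInt.padic_norm_e_of_padicInt]
  exact PadicInt.isUnit_iff.mp u.isUnit

/-- The `q`-adic norm of `ε p^m q^n ∈ Γ` is `q^{-n}`. [folklore] -/
private theorem norm_gamma_Qq {ε : ℚ} (hε : ε = 1 ∨ ε = -1) (m n : ℤ) :
    ‖((ε * (p : ℚ) ^ m * (q : ℚ) ^ n : ℚ) : ℚ_[q])‖ = (q : ℝ) ^ (-n) := by
  have hεn : ‖((ε : ℚ) : ℚ_[q])‖ = 1 := by rcases hε with h | h <;> simp [h]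
  push_cast
  rw [norm_mul, norm_mul, Padic.norm_p_zpow, norm_zpow, norm_p_Qq p q, one_zpow, mul_one, hεn,
    one_mul]

/-- **Injectivity** (the fundamental-domain argument of the printed proof: if `ε p^m q^n` maps `(0,u',c')` to
`(0,u,c)` with `u, u' ∈ ℤ_q^*`, `c, c' > 0`, then `n = 0` by `q`-adic norms and `ε = 1` by signs).
[cite: ConnesConsani2024KnotsPrimes, proof of Prop. 3.1 (iii) p. 6] -/
theorem torusToClass_injective : Function.Injective (torusToClass p q) := by
  rintro ⟨x⟩ ⟨y⟩ h
  change domainToClass p q x = domainToClass p q y at h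
  apply Quotient.sound
  change (torusSetoid p q).r x y
  rw [domainToClass, domainToClass, cls_eq_cls_iff] at h
  obtain ⟨⟨γ, hγ⟩, hxy⟩ := h
  obtain ⟨ε, m, n, hε, hγv⟩ := (mem_Gamma p q).mp hγ
  rw [Subgroup.mk_smul, units_smul_def, hγv] at hxy
  simp only [Prod.mk.injEq] at hxy
  obtain ⟨-, hq', hr⟩ := hxy
  -- `q`-adic norms force `n = 0`
  have hn : n = 0 := by
    have h1 := congrArg (fun z : ℚ_[q] => ‖z‖) hq'
    simp only [norm_mul, norm_coe_unit, norm_gamma_Qq p q hε, mul_one] at h1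
    have hq1 : (1 : ℝ) < q := by exact_mod_cast hq.out.one_lt
    have h0 : (q : ℝ) ^ (-n) = (q : ℝ) ^ (0 : ℤ) := by rw [zpow_zero]; exact h1
    have := zpow_right_injective₀ (by linarith) hq1.ne' h0
    linarith
  subst hn
  simp only [zpow_zero, mul_one] at hq' hr
  -- signs force `ε = 1`
  have hε1 : ε = 1 := by
    rcases hε with h | h
    · exact h
    · exfalso
      subst h
      have hx2 := x.2.2
      have hy2 := y.2.2
      have hpm : 0 < (p : ℝ) ^ m := zpow_pos (by exact_mod_cast hp.out.pos) m
      have : (x.2 : ℝ) = -((p : ℝ) ^ m * y.2) := by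
        rw [← hr]; push_cast; ring
      nlinarith [mul_pos hpm hy2]
  subst hε1
  have hp0 : (p : ℚ_[q]) ≠ 0 := by exact_mod_cast hp.out.ne_zero
  have hp0' : (p : ℝ) ≠ 0 := by exact_mod_cast hp.out.ne_zero
  refine ⟨-m, ?_, ?_⟩
  · rw [← hq']
    push_cast
    rw [one_mul, ← mul_assoc, ← zpow_add₀ hp0, neg_add_cancel, zpow_zero, one_mul]
  · rw [← hr]
    push_cast
    rw [one_mul, ← mul_assoc, ← zpow_add₀ hp0', neg_add_cancel, zpow_zero, one_mul]

omit hpq in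
/-- **Range** `= Ω_{{p}}` ("The action of `{±q^n}` on `{0} × (ℚ_q ∖ {0}) × ℝ^*` admits
`{0} × ℤ_q^* × ℝ_+^*` as fundamental domain": normalise `b ∈ ℚ_q^*` by `q^{-v(b)}` to a unit and the sign of
the real coordinate by `±1`). [cite: ConnesConsani2024KnotsPrimes, proof of Prop. 3.1 (iii) p. 6] -/
theorem range_torusToClass : Set.range (torusToClass p q) = omegaP p q := by
  ext z
  constructor
  · rintro ⟨⟨x⟩, rfl⟩
    refine ⟨((x.1 : ℤ_[q]) : ℚ_[q]), (x.2 : ℝ), ?_, x.2.2.ne', rfl⟩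
    intro h0
    have := norm_coe_unit q x.1
    rw [h0, norm_zero] at this
    exact zero_ne_one this
  · rintro ⟨b, c, hb, hc, rfl⟩
    -- normalise `b` to a unit of `ℤ_q`
    set v : ℤ := b.valuation with hv
    have hq0r : (q : ℝ) ≠ 0 := by exact_mod_cast hq.out.ne_zero
    set y : ℚ_[q] := (q : ℚ_[q]) ^ (-v) * b with hy
    have hy1 : ‖y‖ = 1 := by
      rw [hy, norm_mul, Padic.norm_p_zpow, Padic.norm_eq_zpow_neg_valuation hb, ← hv, neg_neg,
        ← zpow_add₀ hq0r, add_neg_cancel, zpow_zero]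
    -- the sign of `c`
    set ε : ℚ := if 0 < c then 1 else -1 with hε
    have hε' : ε = 1 ∨ ε = -1 := by
      rw [hε]; split_ifs <;> simp
    have hεc : 0 < (ε : ℝ) * c := by
      rcases lt_or_gt_of_ne hc with h | h
      · rw [hε, if_neg (not_lt.mpr h.le)]; push_cast; nlinarith
      · rw [hε, if_pos h]; push_cast; linarith
    have hεnorm : ‖((ε : ℚ) : ℚ_[q])‖ = 1 := by rcases hε' with h | h <;> simp [h]
    -- the unit `ε y`
    have hεy1 : ‖((ε : ℚ) : ℚ_[q]) * y‖ = 1 := by rw [norm_mul, hεnorm, hy1, one_mul]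
    let u0 : ℤ_[q] := ⟨((ε : ℚ) : ℚ_[q]) * y, hεy1.le⟩
    have hu0 : IsUnit u0 := PadicInt.isUnit_iff.mpr (by rw [PadicInt.norm_def]; exact hεy1)
    have hqv : 0 < (q : ℝ) ^ (-v) := zpow_pos (by exact_mod_cast hq.out.pos) _
    refine ⟨Quotient.mk _ (hu0.unit, ⟨(q : ℝ) ^ (-v) * ((ε : ℝ) * c), mul_pos hqv hεc⟩), ?_⟩
    -- the class of `(0, ε y, q^{-v} ε c)` is the class of `(0, b, c)`: act by `γ = ε q^{-v} ∈ Γ`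
    change domainToClass p q _ = _
    rw [domainToClass, cls_eq_cls_iff]
    have hγ0 : (ε * (p : ℚ) ^ (0 : ℤ) * (q : ℚ) ^ (-v) : ℚ) ≠ 0 := by
      have hq0 : (q : ℚ) ≠ 0 := by exact_mod_cast hq.out.ne_zero
      rcases hε' with h | h <;> simp [h, hq0, zpow_ne_zero]
    have hγmem : Units.mk0 _ hγ0 ∈ Gamma p q := ⟨ε, 0, -v, hε', Units.val_mk0 hγ0⟩
    refine ⟨⟨Units.mk0 _ hγ0, hγmem⟩, ?_⟩
    rw [Subgroup.mk_smul, units_smul_def]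
    simp only [Units.val_mk0, mul_zero, IsUnit.unit_spec, Prod.mk.injEq]
    refine ⟨trivial, ?_, ?_⟩
    · change ((ε * (p : ℚ) ^ (0 : ℤ) * (q : ℚ) ^ (-v) : ℚ) : ℚ_[q]) * b = ((ε : ℚ) : ℚ_[q]) * y
      rw [hy]; push_cast; simp only [zpow_zero, mul_one]; ring
    · push_cast; simp only [zpow_zero, mul_one]; ring

/-- **Connes–Consani 2024, Proposition 3.1 (iii) (= the content of Theorem 1.2): `Ω_{{p}} = π_S⁻¹(C_p)` is
(in bijection with) the mapping torus `p^ℤ\(ℤ_q^* × ℝ_+^*)` of multiplication by `p` on `ℤ_q^*`.**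
[cite: ConnesConsani2024KnotsPrimes, Prop. 3.1 (iii) p. 6; Thm. 1.2 p. 3] -/
def mappingTorusEquivOmegaP : MappingTorus p q ≃ omegaP p q :=
  (Equiv.ofInjective _ (torusToClass_injective p q)).trans (Equiv.setCongr (range_torusToClass p q))

/-- The value of the bijection: `[(u, c)] ↦ [(0, u, c)]`. [cite: ConnesConsani2024KnotsPrimes, Prop. 3.1 (iii) p. 6] -/
theorem mappingTorusEquivOmegaP_apply (x : TorusDomain q) :
    ((mappingTorusEquivOmegaP p q (Quotient.mk _ x) : omegaP p q) : SemilocalClassSpace p q) =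
      cls p q ((0 : ℚ_[p]), ((x.1 : ℤ_[q]) : ℚ_[q]), (x.2 : ℝ)) :=
  rfl

omit hpq in
/-- **Equivariance** for the scaling action of `ℝ_+^* ⊂ J_S` on the archimedean coordinate: scaling the
torus point `(u, c) ↦ (u, λc)` corresponds to scaling the adele `(0, u, c) ↦ (0, u, λc)` ("equivariantly
isomorphic", Prop. 3.1 (iii)). [cite: ConnesConsani2024KnotsPrimes, Prop. 3.1 (iii) p. 6] -/
theorem torusToClass_scale (u : ℤ_[q]ˣ) (c : {c : ℝ // 0 < c}) {lam : ℝ} (hlam : 0 < lam) :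
    torusToClass p q (Quotient.mk _ (u, ⟨lam * c, mul_pos hlam c.2⟩)) =
      cls p q ((0 : ℚ_[p]), ((u : ℤ_[q]) : ℚ_[q]), lam * (c : ℝ)) :=
  rfl

end Semilocal

end Literature.NumberTheory.ConnesConsani2024

end
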